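import Summits.QuantumFields.YangMills.Theorems.ColdStartUniversalityLatticeLangevinDossSussmannSmoothingTwo
import Summits.QuantumFields.YangMills.Theorems.ColdStartUniversalityLatticeLangevinDossSussmannFlowThirdOrder
import Summits.QuantumFields.YangMills.Theorems.ColdStartUniversalityLatticeLangevinDossSussmannSmoothingPrep3
import HarnessLib

/-!
# Route `ColdStartUniversality` (fixed-cut-off SZZ dynamics; Doss–Sussmann smoothing programme, file 13):
# `P_t(C³) ⊂ C³` — THE MARKOV TRANSITION OPERATOR PRESERVES `C³`

Helper file (seat `ym-line-csu-p1`, g24).  Third step of the smoothing programme, now through the ORDER-AGNOSTIC chain: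
per-sample `C³` regularity of the integrand `M ↦ f(L_ω Φ^ω_1(coords R M))` with bounds on ALL derivatives of order `≤ 3`
obtained from Mathlib's Faà di Bruno estimate (`norm_iteratedFDerivWithin_comp_le`) — the sample enters only through the
uniform flow bounds of files 2/7/11 (`‖DΦ‖ ≤ e^{TK}`, `‖D²Φ‖ ≤ e^{TK+TKe^{TK}}`, `‖D³Φ‖ ≤ C₃`) — and the any-order
differentiation lemma of file 12.
* `norm_iteratedFDeriv_le_of_fderiv_bounds` — `‖D^iΦ₁‖`, `i = 1, 2, 3`, from nested-`fderiv` bounds;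
* `integrand_regularity₃` — the per-sample `C³` package with a uniform bound on `‖D^k(f ∘ L ∘ Φ₁ ∘ cR)‖`, `k ≤ 3`;
* ★★★ `markovTransition_contDiff_three` — for `f ∈ C³` of the ambient coordinates there is `g ∈ C³` with
  `𝔼 f(coords U^x_t) = g(coords x)` for all `x ∈ SU(2)^E`.
THEOREMS ONLY, no sorry.  HONEST FRAMING: fixed-cut-off regularity (`C³` is the order of the tree's Dynkin class); nothing
K-uniform; no crux, rung or summit statement is proved; the Yang–Mills mass gap is NOT proved.
-/

set_option autoImplicit false

noncomputable section

namespace Summit.QuantumFields.YangMills.Theorems.ColdStartUniversality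

open MeasureTheory Finset Filter Set Metric Function unitInterval
open scoped NNReal Matrix Topology Nat
open Literature.MathematicalPhysics.QuantumFieldTheory
open Literature.MathematicalPhysics.QuantumLattice (fundamentalRep fundamentalLatticeRep continuous_fundamentalRep
  fundamentalRep_mem_unitaryGroup)

variable {L : ℕ}

/-! ## Iterated-derivative norms from nested `fderiv` bounds -/

/-- `‖D¹Φ₁(y)‖`, `‖D²Φ₁(y)‖`, `‖D³Φ₁(y)‖` (as multilinear maps) from bounds on the nested Fréchet derivatives, the third
one in applied form. [folklore] -/
theorem norm_iteratedFDeriv_le_of_fderiv_bounds {E F : Type*} [NormedAddCommGroup E] [NormedSpace ℝ E]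
    [NormedAddCommGroup F] [NormedSpace ℝ F] {Φ₁ : E → F} {E₁ E₂ E₃ : ℝ} (hE₃ : 0 ≤ E₃)
    (h1 : ∀ y, ‖fderiv ℝ Φ₁ y‖ ≤ E₁) (h2 : ∀ y, ‖fderiv ℝ (fderiv ℝ Φ₁) y‖ ≤ E₂)
    (h3 : ∀ y dx dx' δ, ‖fderiv ℝ (fderiv ℝ (fderiv ℝ Φ₁)) y dx dx' δ‖ ≤ E₃ * ‖dx‖ * ‖dx'‖ * ‖δ‖) (y : E) :
    ‖iteratedFDeriv ℝ 1 Φ₁ y‖ ≤ E₁ ∧ ‖iteratedFDeriv ℝ 2 Φ₁ y‖ ≤ E₂ ∧ ‖iteratedFDeriv ℝ 3 Φ₁ y‖ ≤ E₃ := by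
  refine ⟨?_, ?_, ?_⟩
  · rw [norm_iteratedFDeriv_one]; exact h1 y
  · rw [← norm_iteratedFDeriv_fderiv, norm_iteratedFDeriv_one]; exact h2 y
  · refine ContinuousMultilinearMap.opNorm_le_bound hE₃ fun m => ?_
    rw [iteratedFDeriv_succ_apply_right, iteratedFDeriv_two_apply, Fin.prod_univ_three]
    have h := h3 y (Fin.init m 0) (Fin.init m 1) (m (Fin.last 2))
    simp only [Fin.init, Fin.castSucc_zero, Fin.castSucc_one] at h
    calc _ ≤ E₃ * ‖m 0‖ * ‖m 1‖ * ‖m (Fin.last 2)‖ := h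
      _ = E₃ * (‖m 0‖ * ‖m 1‖ * ‖m 2‖) := by rw [show (Fin.last 2) = 2 from rfl]; ring

/-! ## Per-sample `C³` package -/

/-- **Per-sample `C³` regularity package for the integrand**, order-agnostic form.  For `φ = f ∘ (L ∘ Φ₁) ∘ cR` with
`f ∈ C³` (all derivatives of order `≤ 3` bounded by `Cf` on the ball of radius `2(1+D)`), `‖L‖ ≤ 2`, `Φ₁ ∈ C³` with
`‖DΦ₁‖ ≤ E₁`, `‖D²Φ₁‖ ≤ E₂`, `‖D³Φ₁‖ ≤ E₃` and `‖Φ₁ y‖ ≤ ‖y‖ + D`, `cR ∈ C³(U₀)` with `‖cR‖ ≤ 1` and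
`‖D^i cR(M)‖ ≤ DR^i` (`1 ≤ i ≤ 3`) at a point `M ∈ U₀`: `φ` is `C³` on `U₀` and
`‖D^k φ(M)‖ ≤ 6·Cf·(max 1 (6·C₁·DR³))³` for all `k ≤ 3`, `C₁ = 2·max(1+D, E₁, E₂, E₃)` (Faà di Bruno twice). [folklore] -/
theorem integrand_regularity₃ {X : Type*} [NormedAddCommGroup X] [NormedSpace ℝ X]
    {f : X → ℝ} (hf : ContDiff ℝ 3 f) {D Cf E₁ E₂ E₃ DR : ℝ} (hD : 0 ≤ D) (hDR : 1 ≤ DR) (hE₃ : 0 ≤ E₃)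
    (hCfb : ∀ i ≤ 3, ∀ z ∈ closedBall (0 : X) (2 * (1 + D)), ‖iteratedFDeriv ℝ i f z‖ ≤ Cf)
    (Lp : X →L[ℝ] X) (hLp : ‖Lp‖ ≤ 2) {Φ₁ : X → X} (hΦ₁ : ContDiff ℝ 3 Φ₁)
    (hΦ₁b : ∀ y, ‖fderiv ℝ Φ₁ y‖ ≤ E₁) (hΦ₁b2 : ∀ y, ‖fderiv ℝ (fderiv ℝ Φ₁) y‖ ≤ E₂)
    (hΦ₁b3 : ∀ y dx dx' δ, ‖fderiv ℝ (fderiv ℝ (fderiv ℝ Φ₁)) y dx dx' δ‖ ≤ E₃ * ‖dx‖ * ‖dx'‖ * ‖δ‖)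
    (hΦ₁n : ∀ y, ‖Φ₁ y‖ ≤ ‖y‖ + D)
    {cR : X → X} {U₀ : Set X} (hU₀ : IsOpen U₀) (hcRs : ContDiffOn ℝ 3 cR U₀) (hcR1 : ∀ M, ‖cR M‖ ≤ 1)
    {M : X} (hM : M ∈ U₀) (hcRb : ∀ i, 1 ≤ i → i ≤ 3 → ‖iteratedFDerivWithin ℝ i cR U₀ M‖ ≤ DR ^ i) :
    ContDiffOn ℝ 3 (fun M => f (Lp (Φ₁ (cR M)))) U₀ ∧
    ∀ k ≤ 3, ‖iteratedFDerivWithin ℝ k (fun M => f (Lp (Φ₁ (cR M)))) U₀ M‖ ≤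
      6 * Cf * (max 1 (6 * (2 * max (1 + D) (max E₁ (max E₂ E₃))) * DR ^ 3)) ^ 3 := by
  set C₁ : ℝ := 2 * max (1 + D) (max E₁ (max E₂ E₃)) with hC₁
  set Dt : ℝ := max 1 (6 * C₁ * DR ^ 3) with hDt
  have hC₁nn : 0 ≤ C₁ := by rw [hC₁]; exact mul_nonneg (by norm_num) ((by linarith : 0 ≤ 1 + D).trans (le_max_left _ _))
  have hDt1 : 1 ≤ Dt := le_max_left _ _
  have hCfnn : 0 ≤ Cf := (norm_nonneg _).trans (hCfb 0 (by norm_num) 0 (mem_closedBall_self (by positivity)))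
  -- the inner map `h = (L ∘ Φ₁) ∘ cR`
  have hΘs : ContDiff ℝ 3 (⇑Lp ∘ Φ₁) := Lp.contDiff.comp hΦ₁
  have hhs : ContDiffOn ℝ 3 ((⇑Lp ∘ Φ₁) ∘ cR) U₀ := hΘs.comp_contDiffOn hcRs
  have heq : (fun M => f (Lp (Φ₁ (cR M)))) = f ∘ ((⇑Lp ∘ Φ₁) ∘ cR) := rfl
  have hrange : ((⇑Lp ∘ Φ₁) ∘ cR) M ∈ closedBall (0 : X) (2 * (1 + D)) := by
    refine mem_closedBall_zero_iff.2 ?_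
    calc ‖Lp (Φ₁ (cR M))‖ ≤ ‖Lp‖ * ‖Φ₁ (cR M)‖ := Lp.le_opNorm _
      _ ≤ 2 * (1 + D) := mul_le_mul hLp ((hΦ₁n _).trans (by linarith [hcR1 M])) (norm_nonneg _) (by norm_num)
  -- derivatives of `L ∘ Φ₁` of order `≤ 3` are bounded by `C₁`
  have hiter := norm_iteratedFDeriv_le_of_fderiv_bounds hE₃ hΦ₁b hΦ₁b2 hΦ₁b3 (cR M)
  have hΘb : ∀ i, i ≤ 3 → ‖iteratedFDerivWithin ℝ i (⇑Lp ∘ Φ₁) univ (cR M)‖ ≤ C₁ := by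
    intro i hi
    rw [iteratedFDerivWithin_univ]
    have hmax1 : 2 * (1 + D) ≤ C₁ := by rw [hC₁]; gcongr; exact le_max_left _ _
    have hE₁C : 2 * E₁ ≤ C₁ := by
      rw [hC₁]; gcongr; exact (le_max_left _ _).trans (le_max_right _ _)
    have hE₂C : 2 * E₂ ≤ C₁ := by
      rw [hC₁]; gcongr; exact ((le_max_left _ _).trans (le_max_right _ _)).trans (le_max_right _ _)
    have hE₃C : 2 * E₃ ≤ C₁ := by
      rw [hC₁]; gcongr; exact ((le_max_right _ _).trans (le_max_right _ _)).trans (le_max_right _ _)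
    rcases Nat.le_succ_iff.1 hi with hi | hi
    · rcases Nat.le_succ_iff.1 hi with hi | hi
      · rcases Nat.le_succ_iff.1 hi with hi | hi
        · obtain rfl : i = 0 := Nat.le_zero.1 hi
          rw [norm_iteratedFDeriv_zero]
          exact (mem_closedBall_zero_iff.1 hrange).trans hmax1
        · subst hi
          refine (Lp.norm_iteratedFDeriv_comp_left hΦ₁.contDiffAt (by norm_num)).trans ?_
          exact (mul_le_mul hLp hiter.1 (norm_nonneg _) (by norm_num)).trans hE₁C
      · subst hi
        refine (Lp.norm_iteratedFDeriv_comp_left hΦ₁.contDiffAt (by norm_num)).trans ?_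
        exact (mul_le_mul hLp hiter.2.1 (norm_nonneg _) (by norm_num)).trans hE₂C
    · subst hi
      refine (Lp.norm_iteratedFDeriv_comp_left hΦ₁.contDiffAt (by norm_num)).trans ?_
      exact (mul_le_mul hLp hiter.2.2 (norm_nonneg _) (by norm_num)).trans hE₃C
  -- Faà di Bruno, inner: `‖D^n h(M)‖ ≤ n! C₁ DR^n ≤ Dt ≤ Dt^n`
  have hhb : ∀ n, 1 ≤ n → n ≤ 3 → ‖iteratedFDerivWithin ℝ n ((⇑Lp ∘ Φ₁) ∘ cR) U₀ M‖ ≤ Dt ^ n := by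
    intro n hn1 hn3
    have hFdB := norm_iteratedFDerivWithin_comp_le (𝕜 := ℝ) (g := ⇑Lp ∘ Φ₁) (f := cR) (n := n) (N := 3)
      (s := U₀) (t := univ) (x := M) hΘs.contDiffOn hcRs (by exact_mod_cast hn3) uniqueDiffOn_univ hU₀.uniqueDiffOn
      (mapsTo_univ _ _) hM (C := C₁) (D := DR) (fun i hi => hΘb i (hi.trans hn3))
      (fun i hi1 hin => hcRb i hi1 (hin.trans hn3))
    refine hFdB.trans ?_
    have hfact : ((n ! : ℕ) : ℝ) ≤ 6 := by
      have : n ! ≤ 3 ! := Nat.factorial_le hn3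
      exact_mod_cast this
    have hDRn : DR ^ n ≤ DR ^ 3 := pow_le_pow_right₀ hDR hn3
    calc ((n ! : ℕ) : ℝ) * C₁ * DR ^ n ≤ 6 * C₁ * DR ^ 3 := by gcongr
      _ ≤ Dt := le_max_right _ _
      _ ≤ Dt ^ n := le_self_pow₀ hDt1 (by omega)
  refine ⟨by rw [heq]; exact hf.comp_contDiffOn hhs, fun k hk => ?_⟩
  rw [heq]
  have hFdB := norm_iteratedFDerivWithin_comp_le (𝕜 := ℝ) (g := f) (f := (⇑Lp ∘ Φ₁) ∘ cR) (n := k) (N := 3)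
    (s := U₀) (t := univ) (x := M) hf.contDiffOn hhs (by exact_mod_cast hk) uniqueDiffOn_univ hU₀.uniqueDiffOn
    (mapsTo_univ _ _) hM (C := Cf) (D := Dt)
    (fun i hi => by rw [iteratedFDerivWithin_univ]; exact hCfb i (hi.trans hk) _ hrange)
    (fun i hi1 hik => hhb i hi1 (hik.trans hk))
  refine hFdB.trans ?_
  have hfact : ((k ! : ℕ) : ℝ) ≤ 6 := by
    have : k ! ≤ 3 ! := Nat.factorial_le hk
    exact_mod_cast this
  have hDtk : Dt ^ k ≤ Dt ^ 3 := pow_le_pow_right₀ hDt1 hk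
  calc ((k ! : ℕ) : ℝ) * Cf * Dt ^ k ≤ 6 * Cf * Dt ^ 3 := by gcongr
    _ = _ := by rw [hDt, hC₁]

/-! ## The main theorem -/

/-- ★★★ **`P_t(C³) ⊂ C³` for the SZZ dynamics at fixed cut-off.**  Let `B` (free, `β = 0`) and `U` (coupling `β`) be
regular solution families of the SZZ lattice Langevin SDE on `SU(2)^E` driven by the same flat noise, `t ≥ 0`, and
`f` a `C³` function of the ambient matrix coordinates.  Then there is a `C³` function `g` of the ambient coordinates with
`𝔼 f(coords U^x_t) = g(coords x)` for every group configuration `x`. [folklore] -/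
theorem markovTransition_contDiff_three [NeZero L] (β : ℝ)
    {Ω : Type} [MeasurableSpace Ω] {P : Measure Ω} [IsProbabilityMeasure P]
    {W : ℝ≥0 → Ω → (Edge 3 L × NoiseIdx 2 → ℝ)} (hW : IsFlatBrownian W P)
    (B U : GaugeConfig 3 L (Matrix.specialUnitaryGroup (Fin 2) ℂ) → ℝ≥0 → Ω →
      GaugeConfig 3 L (Matrix.specialUnitaryGroup (Fin 2) ℂ))
    (hB : ∀ x, (∀ ω, B x 0 ω = x) ∧
      (latticeLangevinDynamics (fundamentalLatticeRep 2) 0).IsSolution (fundamentalRep (Fin 2)) hW.natFiltration P W (B x))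
    (hBm : ∀ i : ℝ≥0, Measurable[@Prod.instMeasurableSpace (Set.Iic i)
        (GaugeConfig 3 L (Matrix.specialUnitaryGroup (Fin 2) ℂ) × Ω) inferInstance
        (@Prod.instMeasurableSpace (GaugeConfig 3 L (Matrix.specialUnitaryGroup (Fin 2) ℂ)) Ω inferInstance
          (hW.natFiltration i))]
      (fun q : Set.Iic i × (GaugeConfig 3 L (Matrix.specialUnitaryGroup (Fin 2) ℂ) × Ω) => B q.2.1 q.1 q.2.2))
    (hU : ∀ x, (∀ ω, U x 0 ω = x) ∧
      (latticeLangevinDynamics (fundamentalLatticeRep 2) β).IsSolution (fundamentalRep (Fin 2)) hW.natFiltration P W (U x))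
    (hUm : ∀ i : ℝ≥0, Measurable[@Prod.instMeasurableSpace (Set.Iic i)
        (GaugeConfig 3 L (Matrix.specialUnitaryGroup (Fin 2) ℂ) × Ω) inferInstance
        (@Prod.instMeasurableSpace (GaugeConfig 3 L (Matrix.specialUnitaryGroup (Fin 2) ℂ)) Ω inferInstance
          (hW.natFiltration i))]
      (fun q : Set.Iic i × (GaugeConfig 3 L (Matrix.specialUnitaryGroup (Fin 2) ℂ) × Ω) => U q.2.1 q.1 q.2.2))
    (t : ℝ≥0) {f : (Edge 3 L → Fin (fundamentalLatticeRep 2).N → Fin (fundamentalLatticeRep 2).N → ℂ) → ℝ}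
    (hf : ContDiff ℝ 3 f) :
    ∃ g : (Edge 3 L → Fin (fundamentalLatticeRep 2).N → Fin (fundamentalLatticeRep 2).N → ℂ) → ℝ,
      ContDiff ℝ 3 g ∧
      ∀ x : GaugeConfig 3 L (Matrix.specialUnitaryGroup (Fin 2) ℂ),
        ∫ ω, f (fun (e : Edge 3 L) (k l : Fin (fundamentalLatticeRep 2).N) =>
            (fundamentalLatticeRep 2).ρ (U x t ω e) k l) ∂P =
          g (fun (e : Edge 3 L) (k l : Fin (fundamentalLatticeRep 2).N) => (fundamentalLatticeRep 2).ρ (x e) k l) := by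
  classical
  let Cfg : Type := Edge 3 L → Fin (fundamentalLatticeRep 2).N → Fin (fundamentalLatticeRep 2).N → ℂ
  obtain ⟨coords, hcoords⟩ : ∃ coords : GaugeConfig 3 L (Matrix.specialUnitaryGroup (Fin 2) ℂ) → Cfg,
      coords = fun x e k l => (fundamentalLatticeRep 2).ρ (x e) k l := ⟨_, rfl⟩
  have hcoords_c : Continuous coords := by rw [hcoords]; exact continuous_coordsRho (L := L)
  have hcoords1 : ∀ x, ‖coords x‖ ≤ 1 := fun x => by rw [hcoords]; exact norm_frame_config_le_one (L := L) x
  have hmU : ∀ x u, Measurable (U x u) := fun x u => ((hU x).2.adapted u).mono (hW.natFiltration.le u) le_rfl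
  -- (1) bump-tamed field, (2) retraction
  obtain ⟨G, hG, hGF, hG0⟩ := exists_tamed_dossSussmannField_vanishing (L := L) β
  have hGc : Continuous G := hG.continuous
  obtain ⟨R, U₀, χ, hU₀, hxU₀', hRx', hRs', hχs, hχx', hχ0⟩ := exists_smooth_retraction_rho L
  have hxU₀ : ∀ x, coords x ∈ U₀ := fun x => by rw [hcoords]; exact hxU₀' x
  have hRx : ∀ x, R (coords x) = x := fun x => by rw [hcoords]; exact hRx' x
  have hRs : ContDiffOn ℝ (⊤ : ℕ∞) (fun M => coords (R M)) U₀ := by rw [hcoords]; exact hRs'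
  have hχx : ∀ x, χ (coords x) = 1 := fun x => by rw [hcoords]; exact hχx' x
  set T : ℝ := (t : ℝ) with hTdef
  have hT0 : 0 ≤ T := t.2
  -- (3) frame paths
  obtain ⟨craw, hcraw⟩ : ∃ craw : Ω → I → Cfg,
      craw = fun ω (τ : I) e k l => (fundamentalLatticeRep 2).ρ (B 1 (T * (τ : ℝ)).toNNReal ω e) k l := ⟨_, rfl⟩
  have hcraw1 : ∀ ω τ, ‖craw ω τ‖ ≤ 1 := fun ω τ => by
    rw [hcraw]; exact norm_frame_config_le_one (L := L) (fun e => B 1 (T * (τ : ℝ)).toNNReal ω e)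
  obtain ⟨c, hc⟩ : ∃ c : Ω → C(I, Cfg), c = fun ω =>
      if h : Continuous (craw ω) then ⟨craw ω, h⟩ else ContinuousMap.const I (craw ω 0) := ⟨_, rfl⟩
  have hc1 : ∀ ω τ, ‖c ω τ‖ ≤ 1 := by
    intro ω τ
    rw [hc]
    by_cases h : Continuous (craw ω)
    · simp only [h, dif_pos]; exact hcraw1 ω τ
    · simp only [h, dif_neg, not_false_eq_true, ContinuousMap.const_apply]; exact hcraw1 ω 0
  -- (4) flows with third-order bounds, (5) left multiplications
  have h3 := exists_dossSussmannFlow₃ (L := L) hG hG0 hT0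
  obtain ⟨K, C₃, hK0, hK1, hK2, hK3, hflow⟩ := h3
  choose Φ hΦeq hΦuniq hΦs hΦder hΦdisp hΦder2 hΦder3 using fun ω => hflow (c ω) (hc1 ω)
  choose Lp hLp hLpn using fun ω =>
    (exists_leftMul_clm (L := L) (craw ω 1) : ∃ Lp : Cfg →L[ℝ] Cfg,
      (∀ V, Lp V = fun (e : Edge 3 L) (k l : Fin (fundamentalLatticeRep 2).N) =>
        (Matrix.of (craw ω 1 e) * Matrix.of (V e)) k l) ∧ ‖Lp‖ ≤ 2 * ‖craw ω 1‖)
  have hLp2 : ∀ ω, ‖Lp ω‖ ≤ 2 := fun ω =>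
    calc ‖Lp ω‖ ≤ 2 * ‖craw ω 1‖ := hLpn ω
      _ ≤ 2 * 1 := by gcongr; exact hcraw1 ω 1
      _ = 2 := by norm_num
  -- (6) the retraction in coordinates, the flow at time one, the integrand
  obtain ⟨cR, hcR⟩ : ∃ cR : Cfg → Cfg, cR = fun M => coords (R M) := ⟨_, rfl⟩
  have hcR1 : ∀ M, ‖cR M‖ ≤ 1 := fun M => by rw [hcR]; exact hcoords1 (R M)
  have hcRs : ContDiffOn ℝ (⊤ : ℕ∞) cR U₀ := by rw [hcR]; exact hRs
  have hcRs3 : ContDiffOn ℝ 3 cR U₀ := contDiffOn_infty.1 hcRs 3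
  obtain ⟨Φ1, hΦ1⟩ : ∃ Φ1 : Ω → Cfg → Cfg, Φ1 = fun ω y => Φ ω y 1 := ⟨_, rfl⟩
  have hΦ1s : ∀ ω, ContDiff ℝ (⊤ : ℕ∞) (Φ1 ω) := fun ω => by
    rw [hΦ1]; exact (ContinuousMap.evalCLM ℝ (1 : I) (M := Cfg)).contDiff.comp (hΦs ω)
  have hΦ1s3 : ∀ ω, ContDiff ℝ 3 (Φ1 ω) := fun ω => contDiff_infty.1 (hΦ1s ω) 3
  have hΦ1b : ∀ ω y, ‖fderiv ℝ (Φ1 ω) y‖ ≤ Real.exp (T * K) := fun ω y => by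
    have h := hΦder ω y 1
    rw [Set.Icc.coe_one, mul_one] at h
    rw [hΦ1]
    exact h
  have hΦ1b2 : ∀ ω y, ‖fderiv ℝ (fderiv ℝ (Φ1 ω)) y‖ ≤ Real.exp (T * K + T * K * Real.exp (T * K)) := fun ω y => by
    have h := hΦder2 ω y 1
    rw [Set.Icc.coe_one, mul_one] at h
    rw [hΦ1]
    exact h
  have hC₃ : 0 ≤ max C₃ 0 := le_max_right _ _
  have hΦ1b3 : ∀ ω y (dx dx' δ : Cfg), ‖fderiv ℝ (fderiv ℝ (fderiv ℝ (Φ1 ω))) y dx dx' δ‖ ≤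
      max C₃ 0 * ‖dx‖ * ‖dx'‖ * ‖δ‖ := fun ω y dx dx' δ => by
    rw [hΦ1]
    refine (hΦder3 ω y 1 dx dx' δ).trans ?_
    have h0 : 0 ≤ ‖dx‖ * ‖dx'‖ * ‖δ‖ := by positivity
    calc C₃ * ‖dx‖ * ‖dx'‖ * ‖δ‖ = C₃ * (‖dx‖ * ‖dx'‖ * ‖δ‖) := by ring
      _ ≤ max C₃ 0 * (‖dx‖ * ‖dx'‖ * ‖δ‖) := mul_le_mul_of_nonneg_right (le_max_left _ _) h0
      _ = max C₃ 0 * ‖dx‖ * ‖dx'‖ * ‖δ‖ := by ring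
  have hΦ1n : ∀ ω y, ‖Φ1 ω y‖ ≤ ‖y‖ + T * K := fun ω y => by
    have h := hΦdisp ω y 1
    simp only [Set.Icc.coe_one, mul_one] at h
    rw [hΦ1]
    calc ‖Φ ω y 1‖ = ‖(Φ ω y 1 - y) + y‖ := by rw [sub_add_cancel]
      _ ≤ ‖Φ ω y 1 - y‖ + ‖y‖ := norm_add_le _ _
      _ ≤ T * K + ‖y‖ := by gcongr
      _ = ‖y‖ + T * K := add_comm _ _
  obtain ⟨F, hF⟩ : ∃ F : Cfg → Ω → ℝ, F = fun M ω => f (Lp ω (Φ1 ω (cR M))) := ⟨_, rfl⟩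
  -- bounds on the derivatives of `f` of order `≤ 3` on the relevant ball
  have hTK : 0 ≤ T * K := mul_nonneg hT0 K.2
  have hfbd : ∀ i ≤ 3, ∃ C, 0 ≤ C ∧ ∀ z ∈ closedBall (0 : Cfg) (2 * (1 + T * K)), ‖iteratedFDeriv ℝ i f z‖ ≤ C :=
    fun i hi => exists_bound_on_closedBall (g := iteratedFDeriv ℝ i f) (U := univ) (M₀ := (0 : Cfg))
      (r := 2 * (1 + T * K)) ((hf.continuous_iteratedFDeriv (by exact_mod_cast hi)).continuousOn) (subset_univ _)
  have hf0 := hfbd 0 (by norm_num)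
  have hf1 := hfbd 1 (by norm_num)
  have hf2 := hfbd 2 (by norm_num)
  have hf3 := hfbd 3 le_rfl
  obtain ⟨Cf0, -, hCf0⟩ := hf0
  obtain ⟨Cf1, -, hCf1⟩ := hf1
  obtain ⟨Cf2, -, hCf2⟩ := hf2
  obtain ⟨Cf3, -, hCf3⟩ := hf3
  obtain ⟨Cf, hCf⟩ : ∃ Cf : ℝ, ∀ i ≤ 3, ∀ z ∈ closedBall (0 : Cfg) (2 * (1 + T * K)),
      ‖iteratedFDeriv ℝ i f z‖ ≤ Cf := by
    refine ⟨max (max Cf0 Cf1) (max Cf2 Cf3), fun i hi z hz => ?_⟩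
    rcases Nat.le_succ_iff.1 hi with hi | hi
    · rcases Nat.le_succ_iff.1 hi with hi | hi
      · rcases Nat.le_succ_iff.1 hi with hi | hi
        · obtain rfl : i = 0 := Nat.le_zero.1 hi
          exact (hCf0 z hz).trans ((le_max_left _ _).trans (le_max_left _ _))
        · subst hi; exact (hCf1 z hz).trans ((le_max_right _ _).trans (le_max_left _ _))
      · subst hi; exact (hCf2 z hz).trans ((le_max_left _ _).trans (le_max_right _ _))
    · subst hi; exact (hCf3 z hz).trans ((le_max_right _ _).trans (le_max_right _ _))
  -- (7) the a.s. identity `f(coords U^{R M}_t) = F M`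
  have hrange : ∀ ω M, Lp ω (Φ1 ω (cR M)) ∈ closedBall (0 : Cfg) (2 * (1 + T * K)) := by
    intro ω M
    refine mem_closedBall_zero_iff.2 ?_
    calc ‖Lp ω (Φ1 ω (cR M))‖ ≤ ‖Lp ω‖ * ‖Φ1 ω (cR M)‖ := (Lp ω).le_opNorm _
      _ ≤ 2 * (1 + T * K) :=
          mul_le_mul (hLp2 ω) ((hΦ1n ω _).trans (by linarith [hcR1 M])) (norm_nonneg _) (by norm_num)
  have hae : ∀ M, (fun ω => f (coords (U (R M) t ω))) =ᵐ[P] F M := by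
    intro M
    filter_upwards [dossSussmann_flow_representation (L := L) β hGc hGF hW B U hB hBm hU hUm 1 (R M) hT0]
      with ω hω
    obtain ⟨hcont, hrep⟩ := hω
    have hcω_cont : Continuous (craw ω) := by rw [hcraw]; exact hcont
    have hcω : c ω = ⟨craw ω, hcω_cont⟩ := by rw [hc]; exact dif_pos hcω_cont
    have huniq := hΦuniq ω
    rw [hcω] at huniq
    subst hcraw
    have key := hrep (Φ ω) huniq 1
    have ht1 : (T * ((1 : I) : ℝ)).toNNReal = t := by simp [hTdef]
    have hstart : (fun (e : Edge 3 L) (k l : Fin (fundamentalLatticeRep 2).N) =>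
        (((fundamentalLatticeRep 2).ρ ((1 : GaugeConfig 3 L (Matrix.specialUnitaryGroup (Fin 2) ℂ)) e))ᴴ *
          (fundamentalLatticeRep 2).ρ (R M e)) k l) = cR M := by
      rw [hcR, hcoords]; funext e k l
      have h1e : (1 : GaugeConfig 3 L (Matrix.specialUnitaryGroup (Fin 2) ℂ)) e = 1 := rfl
      show (((fundamentalLatticeRep 2).ρ ((1 : GaugeConfig 3 L (Matrix.specialUnitaryGroup (Fin 2) ℂ)) e))ᴴ *
          (fundamentalLatticeRep 2).ρ (R M e)) k l = (fundamentalLatticeRep 2).ρ (R M e) k l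
      rw [h1e, map_one, Matrix.conjTranspose_one, Matrix.one_mul]
    rw [hstart] at key
    rw [hF]
    show f (coords (U (R M) t ω)) = f (Lp ω (Φ1 ω (cR M)))
    congr 1
    rw [hLp ω, hΦ1, hcoords]
    funext e k l
    rw [← ht1]
    show ((fundamentalLatticeRep 2).ρ (U (R M) (T * ((1 : I) : ℝ)).toNNReal ω e)) k l = _
    rw [key e]
    rfl
  -- measurability of the integrand
  have hFmeas : ∀ M, AEStronglyMeasurable (F M) P := fun M =>
    (((hf.continuous.comp hcoords_c).measurable.comp (hmU (R M) t)).aestronglyMeasurable).congr (hae M)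
  -- (8) per-sample `C³` regularity with uniform bounds, via the order-agnostic package
  have hFφ : ∀ ω, (fun M => F M ω) = fun M => f (Lp ω (Φ1 ω (cR M))) := fun ω => by rw [hF]
  have hpkg := fun ω (M : Cfg) (hM : M ∈ U₀) (DR : ℝ) (hDR : 1 ≤ DR)
      (hcRb : ∀ i, 1 ≤ i → i ≤ 3 → ‖iteratedFDerivWithin ℝ i cR U₀ M‖ ≤ DR ^ i) =>
    integrand_regularity₃ (X := Cfg) hf (D := T * K) hTK hDR hC₃ hCf (Lp ω) (hLp2 ω) (hΦ1s3 ω) (hΦ1b ω)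
      (hΦ1b2 ω) (hΦ1b3 ω) (hΦ1n ω) hU₀ hcRs3 hcR1 hM hcRb
  have hFs3 : ∀ ω, ContDiffOn ℝ 3 (fun M => F M ω) U₀ := fun ω => by
    rw [hFφ]
    obtain ⟨x₀⟩ := (inferInstance : Nonempty (GaugeConfig 3 L (Matrix.specialUnitaryGroup (Fin 2) ℂ)))
    exact (hpkg ω (coords x₀) (hxU₀ x₀) (max 1 (max ‖iteratedFDerivWithin ℝ 1 cR U₀ (coords x₀)‖
      (max ‖iteratedFDerivWithin ℝ 2 cR U₀ (coords x₀)‖ ‖iteratedFDerivWithin ℝ 3 cR U₀ (coords x₀)‖)))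
      (le_max_left _ _) (fun i hi1 hi3 => by
        have hm : (1 : ℝ) ≤ max 1 (max ‖iteratedFDerivWithin ℝ 1 cR U₀ (coords x₀)‖
            (max ‖iteratedFDerivWithin ℝ 2 cR U₀ (coords x₀)‖ ‖iteratedFDerivWithin ℝ 3 cR U₀ (coords x₀)‖)) :=
          le_max_left _ _
        refine le_trans ?_ (le_self_pow₀ hm (by omega))
        rcases Nat.le_succ_iff.1 hi3 with hi | hi
        · rcases Nat.le_succ_iff.1 hi with hi | hi
          · obtain rfl : i = 1 := le_antisymm hi hi1
            exact (le_max_left _ _).trans (le_max_right _ _)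
          · subst hi; exact ((le_max_left _ _).trans (le_max_right _ _)).trans (le_max_right _ _)
        · subst hi; exact ((le_max_right _ _).trans (le_max_right _ _)).trans (le_max_right _ _))).1
  -- local uniform bounds on all derivatives of order `≤ 3`
  have hcRic : ∀ i ≤ 3, ContinuousOn (iteratedFDerivWithin ℝ i cR U₀) U₀ := fun i hi =>
    hcRs3.continuousOn_iteratedFDerivWithin (by exact_mod_cast hi) hU₀.uniqueDiffOn
  have hbd : ∀ M₀ ∈ U₀, ∃ ε > 0, ∃ C : ℝ, ball M₀ ε ⊆ U₀ ∧ ∀ ω, ∀ M ∈ ball M₀ ε, ∀ k ≤ 3,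
      ‖iteratedFDerivWithin ℝ k (fun M => F M ω) U₀ M‖ ≤ C := by
    intro M₀ hM₀
    obtain ⟨ε, hε, hball⟩ := Metric.isOpen_iff.1 hU₀ M₀ hM₀
    have hε2 : 0 < ε / 2 := half_pos hε
    have hcb : closedBall M₀ (ε / 2) ⊆ U₀ := (closedBall_subset_ball (half_lt_self hε)).trans hball
    have hbU : ball M₀ (ε / 2) ⊆ U₀ := ball_subset_closedBall.trans hcb
    obtain ⟨CR1, -, hCR1⟩ := exists_bound_on_closedBall (g := iteratedFDerivWithin ℝ 1 cR U₀) (hcRic 1 (by norm_num)) hcb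
    obtain ⟨CR2, -, hCR2⟩ := exists_bound_on_closedBall (g := iteratedFDerivWithin ℝ 2 cR U₀) (hcRic 2 (by norm_num)) hcb
    obtain ⟨CR3, -, hCR3⟩ := exists_bound_on_closedBall (g := iteratedFDerivWithin ℝ 3 cR U₀) (hcRic 3 le_rfl) hcb
    obtain ⟨DR, hDR1, hcRb⟩ : ∃ DR : ℝ, 1 ≤ DR ∧ ∀ M ∈ closedBall M₀ (ε / 2), ∀ i, 1 ≤ i → i ≤ 3 →
        ‖iteratedFDerivWithin ℝ i cR U₀ M‖ ≤ DR ^ i := by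
      refine ⟨max 1 (max CR1 (max CR2 CR3)), le_max_left _ _, fun M hM' i hi1 hi3 => ?_⟩
      refine le_trans ?_ (le_self_pow₀ (le_max_left _ _) (by omega))
      rcases Nat.le_succ_iff.1 hi3 with hi | hi
      · rcases Nat.le_succ_iff.1 hi with hi | hi
        · obtain rfl : i = 1 := le_antisymm hi hi1
          exact (hCR1 M hM').trans ((le_max_left _ _).trans (le_max_right _ _))
        · subst hi; exact (hCR2 M hM').trans (((le_max_left _ _).trans (le_max_right _ _)).trans (le_max_right _ _))
      · subst hi; exact (hCR3 M hM').trans (((le_max_right _ _).trans (le_max_right _ _)).trans (le_max_right _ _))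
    refine ⟨ε / 2, hε2, 6 * Cf * (max 1 (6 * (2 * max (1 + T * K) (max (Real.exp (T * K))
      (max (Real.exp (T * K + T * K * Real.exp (T * K))) (max C₃ 0)))) * DR ^ 3)) ^ 3, hbU,
      fun ω M hM k hk => ?_⟩
    rw [hFφ]
    exact (hpkg ω M (hbU hM) DR hDR1 (hcRb M (ball_subset_closedBall hM))).2 k hk
  -- (9) differentiation under the expectation, to order three
  obtain ⟨h, hh⟩ : ∃ h : Cfg → ℝ, h = fun M => ∫ ω, F M ω ∂P := ⟨_, rfl⟩
  have hC3 : ContDiffOn ℝ 3 h U₀ := by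
    rw [hh]
    exact contDiffOn_integral_of_iteratedFDerivWithin_le (μ := P) hU₀ 3 (F := F) (fun M _ => hFmeas M) hFs3 hbd
  -- (10) gluing with the cut-off
  refine ⟨fun M => χ M * h M, contDiff_mul_of_eventuallyEq_zero hU₀ hC3 (contDiff_infty.1 hχs 3) hχ0,
    fun x => ?_⟩
  have hχ1 : χ (coords x) = 1 := hχx x
  have hR : R (coords x) = x := hRx x
  have hcx : coords x = fun (e : Edge 3 L) (k l : Fin (fundamentalLatticeRep 2).N) =>
      (fundamentalLatticeRep 2).ρ (x e) k l := by rw [hcoords]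
  show _ = χ _ * h _
  rw [← hcx, hχ1, one_mul, hh]
  show _ = ∫ ω, F (coords x) ω ∂P
  rw [← integral_congr_ae (hae (coords x)), hR, hcoords]

end Summit.QuantumFields.YangMills.Theorems.ColdStartUniversality

end
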